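import Summits.AtomisticToContinuum.HydrodynamicLimit.Theorems.BoxDissipativeWeakStrongLocalGibbsFineScaleCgibbs
import Summits.AtomisticToContinuum.HydrodynamicLimit.Theorems.CollisionIsometryCLTMesoscopicLLNVelocityGauss

/-!
# `LocalGibbsFineScale` (route `BoxDissipativeWeakStrong`), file 6: conditional velocity bounds

Support lemmas for item stmt-AtomisticToContinuum-9905. Given the positions `q` of `n` hard
spheres, the velocities of a local Gibbs state are independent Gaussians
`vᵢ ~ N(u₀(qᵢ), θ₀(qᵢ) 𝟙)` (`velMeasure`). For a one-body weight `χ` (later: the box kernel at a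
kinetic window, read at the particles) we bound the conditional `L¹` deviations of the empirical
momentum and energy fields of the configuration `zipConfig (q, v)` from arbitrary targets:

* `integral_norm_momentum_sub_le`:
  `E_v ‖n⁻¹ ∑ χ(qᵢ) vᵢ - w‖ ≤ ∑ₗ ( √(∑ᵢ (n⁻¹χ(qᵢ))² θ₀(qᵢ)) + |n⁻¹ ∑ χ(qᵢ) u₀(qᵢ)ₗ - wₗ| )`;
* `integral_abs_energy_sub_le`:
  `E_v |n⁻¹ ∑ χ(qᵢ) |vᵢ|²/2 - c| ≤ √(∑ᵢ (n⁻¹χ(qᵢ))² Bᵢ) + |n⁻¹ ∑ χ(qᵢ) e(qᵢ) - c|`,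
  `e = |u₀|²/2 + 3θ₀/2`, `Bᵢ = 6 θ₀(qᵢ)|u₀(qᵢ)|² + θ₀(qᵢ)² K₄/2`;
* `sum_sq_mul_le`: `∑ᵢ (n⁻¹cᵢ)² bᵢ ≤ (n⁻¹ C B) · n⁻¹ ∑ᵢ cᵢ` for `0 ≤ cᵢ ≤ C`, `0 ≤ bᵢ ≤ B` — at a
  kinetic window (`C = ℓ⁻³`, `(n ℓ³)⁻¹ → 0`) the Gaussian fluctuation is `√(o(1) · density)`.

(Cauchy–Schwarz on the conditional second moments `MesoLLN.integral_momCoord_sq`,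
`MesoLLN.integral_energy_sq_le` of file `CollisionIsometryCLTMesoscopicLLNVelocityGauss`.)
-/

noncomputable section

namespace Summit.AtomisticToContinuum.HydrodynamicLimit.Theorems
namespace LGFS
open MeasureTheory ProbabilityTheory Finset Filter Topology Metric
open Literature.MathematicalPhysics.KineticTheory
open scoped ENNReal

/-! ### Elementary inequalities -/

/-- The Euclidean norm of a vector of `ℝ³` is at most the sum of the absolute values of its
coordinates. -/
theorem norm_le_sum_abs (w : V3) : ‖w‖ ≤ ∑ l, |w l| := by
  rw [EuclideanSpace.norm_eq]
  have h0 : 0 ≤ ∑ l, |w l| := sum_nonneg fun l _ => abs_nonneg _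
  refine Real.sqrt_le_iff.2 ⟨h0, ?_⟩
  simp only [Real.norm_eq_abs, Fin.sum_univ_three]
  nlinarith [abs_nonneg (w 0), abs_nonneg (w 1), abs_nonneg (w 2), sq_abs (w 0), sq_abs (w 1), sq_abs (w 2)]

/-- `√(a + b²) ≤ √a + |b|` for `0 ≤ a`. -/
theorem sqrt_add_sq_le {a b : ℝ} (ha : 0 ≤ a) : Real.sqrt (a + b ^ 2) ≤ Real.sqrt a + |b| := by
  have h1 : 0 ≤ Real.sqrt a + |b| := by positivity
  refine Real.sqrt_le_iff.2 ⟨h1, ?_⟩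
  nlinarith [Real.sq_sqrt ha, Real.sqrt_nonneg a, abs_nonneg b, sq_abs b]

/-- **Kinetic-window bound for the conditional variances**: for `0 ≤ cᵢ ≤ C` and `0 ≤ bᵢ ≤ B`,
`∑ᵢ (n⁻¹cᵢ)² bᵢ ≤ (n⁻¹ C B) (n⁻¹ ∑ᵢ cᵢ)`. -/
theorem sum_sq_mul_le {n : ℕ} {c b : Fin n → ℝ} {C B : ℝ} (hc0 : ∀ i, 0 ≤ c i) (hcC : ∀ i, c i ≤ C)
    (hb0 : ∀ i, 0 ≤ b i) (hbB : ∀ i, b i ≤ B) :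
    ∑ i, ((n : ℝ)⁻¹ * c i) ^ 2 * b i ≤ ((n : ℝ)⁻¹ * C * B) * ((n : ℝ)⁻¹ * ∑ i, c i) := by
  rw [mul_sum, mul_sum]
  refine sum_le_sum fun i _ => ?_
  have hn : 0 ≤ (n : ℝ)⁻¹ := inv_nonneg.2 (Nat.cast_nonneg _)
  have h1 : ((n : ℝ)⁻¹ * c i) ^ 2 * b i = (n : ℝ)⁻¹ * (n : ℝ)⁻¹ * c i * (c i * b i) := by ring
  have h2 : (n : ℝ)⁻¹ * C * B * ((n : ℝ)⁻¹ * c i) = (n : ℝ)⁻¹ * (n : ℝ)⁻¹ * c i * (C * B) := by ring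
  rw [h1, h2]
  exact mul_le_mul_of_nonneg_left (mul_le_mul (hcC i) (hbB i) (hb0 i) ((hc0 i).trans (hcC i)))
    (by have := hc0 i; positivity)

/-- `√(κ d) ≤ √κ (1 + d) / 2` for `0 ≤ κ, d` (AM–GM; linear in `d`). -/
theorem sqrt_mul_le_half {κ d : ℝ} (hκ : 0 ≤ κ) (hd : 0 ≤ d) :
    Real.sqrt (κ * d) ≤ Real.sqrt κ * (1 + d) / 2 := by
  rw [Real.sqrt_mul hκ]
  have h1 : Real.sqrt d ≤ (1 + d) / 2 := by
    nlinarith [Real.sq_sqrt hd, Real.sqrt_nonneg d, sq_nonneg (Real.sqrt d - 1)]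
  calc Real.sqrt κ * Real.sqrt d ≤ Real.sqrt κ * ((1 + d) / 2) :=
        mul_le_mul_of_nonneg_left h1 (Real.sqrt_nonneg κ)
    _ = Real.sqrt κ * (1 + d) / 2 := by ring

/-! ### Conditional velocity bounds -/

section Velocity

variable {u₀ : T3 → V3} {θ₀ : T3 → ℝ}

/-- **Momentum-coordinate fluctuation**: under `⊗ᵢ N(u₀(qᵢ), θ₀(qᵢ))`,
`E |n⁻¹ ∑ᵢ cᵢ (vᵢₗ - u₀(qᵢ)ₗ)| ≤ √(∑ᵢ (n⁻¹cᵢ)² θ₀(qᵢ))`, and the fluctuation is in `L²`. -/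
theorem integral_abs_momFluct_le (hθ0 : ∀ x, 0 < θ₀ x) {n : ℕ} (q : Fin n → T3) (c : Fin n → ℝ)
    (l : Fin 3) :
    MemLp (fun v : Fin n → V3 => (n : ℝ)⁻¹ * ∑ i, c i * (v i l - u₀ (q i) l)) 2 (velMeasure u₀ θ₀ q) ∧
    ∫ v, |(n : ℝ)⁻¹ * ∑ i, c i * (v i l - u₀ (q i) l)| ∂velMeasure u₀ θ₀ q ≤
      Real.sqrt (∑ i, ((n : ℝ)⁻¹ * c i) ^ 2 * θ₀ (q i)) := by
  set W := (n : ℝ)⁻¹ * ∑ i, c i * u₀ (q i) l with hW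
  obtain ⟨hint, heq⟩ := MesoLLN.integral_momCoord_sq (u₀ := u₀) hθ0 q c W l
  have hre : ∀ v : Fin n → V3, (n : ℝ)⁻¹ * ∑ i, c i * (v i l - u₀ (q i) l) =
      (n : ℝ)⁻¹ * ∑ i, c i * v i l - W := fun v => by
    rw [hW, ← mul_sub, ← sum_sub_distrib]
    congr 1
    exact sum_congr rfl fun i _ => by ring
  simp_rw [hre]
  rw [sub_self, zero_pow two_ne_zero, add_zero] at heq
  have hmeas : Measurable fun v : Fin n → V3 => (n : ℝ)⁻¹ * ∑ i, c i * v i l - W := by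
    refine (measurable_const.mul (Finset.measurable_sum _ fun i _ => measurable_const.mul ?_)).sub_const _
    have h : Measurable fun p : V3 => p l := by fun_prop
    exact h.comp (measurable_pi_apply i)
  have hmem : MemLp (fun v : Fin n → V3 => (n : ℝ)⁻¹ * ∑ i, c i * v i l - W) 2 (velMeasure u₀ θ₀ q) :=
    (memLp_two_iff_integrable_sq hmeas.aestronglyMeasurable).2 hint
  refine ⟨hmem, ?_⟩
  calc ∫ v, |(n : ℝ)⁻¹ * ∑ i, c i * v i l - W| ∂velMeasure u₀ θ₀ q
      ≤ Real.sqrt (∫ v, ((n : ℝ)⁻¹ * ∑ i, c i * v i l - W) ^ 2 ∂velMeasure u₀ θ₀ q) :=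
        integral_abs_le_sqrt_of_memLp hmem
    _ = Real.sqrt (∑ i, ((n : ℝ)⁻¹ * c i) ^ 2 * θ₀ (q i)) := by rw [heq]

/-- The variance bound of the kinetic energy under `N(u, θ)`: `B(y) = 6 θ₀(y)|u₀(y)|² + θ₀(y)² K₄/2`. -/
theorem energyVarBound_nonneg (hθ0 : ∀ x, 0 < θ₀ x) (y : T3) :
    0 ≤ 2 * 3 * θ₀ y * ‖u₀ y‖ ^ 2 + θ₀ y ^ 2 / 2 * gaussFourthMomentConst (Fin 3) := by
  have := hθ0 y
  have := gaussFourthMomentConst_nonneg (ι := Fin 3)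
  positivity

/-- **Kinetic-energy fluctuation**: under `⊗ᵢ N(u₀(qᵢ), θ₀(qᵢ))`, with `e = |u₀|²/2 + 3θ₀/2`,
`E |n⁻¹ ∑ᵢ cᵢ (|vᵢ|²/2 - e(qᵢ))| ≤ √(∑ᵢ (n⁻¹cᵢ)² Bᵢ)`, and the fluctuation is in `L²`. -/
theorem integral_abs_energyFluct_le (hθ0 : ∀ x, 0 < θ₀ x) {n : ℕ} (q : Fin n → T3) (c : Fin n → ℝ) :
    MemLp (fun v : Fin n → V3 => (n : ℝ)⁻¹ * ∑ i, c i * (‖v i‖ ^ 2 / 2 - ‖u₀ (q i)‖ ^ 2 / 2 -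
      Fintype.card (Fin 3) * θ₀ (q i) / 2)) 2 (velMeasure u₀ θ₀ q) ∧
    ∫ v, |(n : ℝ)⁻¹ * ∑ i, c i * (‖v i‖ ^ 2 / 2 - ‖u₀ (q i)‖ ^ 2 / 2 - Fintype.card (Fin 3) * θ₀ (q i) / 2)|
        ∂velMeasure u₀ θ₀ q ≤
      Real.sqrt (∑ i, ((n : ℝ)⁻¹ * c i) ^ 2 *
        (2 * 3 * θ₀ (q i) * ‖u₀ (q i)‖ ^ 2 + θ₀ (q i) ^ 2 / 2 * gaussFourthMomentConst (Fin 3))) := by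
  set W := (n : ℝ)⁻¹ * ∑ i, c i * (‖u₀ (q i)‖ ^ 2 / 2 + 3 / 2 * θ₀ (q i)) with hW
  obtain ⟨hint, hle⟩ := MesoLLN.integral_energy_sq_le (u₀ := u₀) hθ0 q c W
  have hre : ∀ v : Fin n → V3, (n : ℝ)⁻¹ * ∑ i, c i * (‖v i‖ ^ 2 / 2 - ‖u₀ (q i)‖ ^ 2 / 2 -
      Fintype.card (Fin 3) * θ₀ (q i) / 2) = (n : ℝ)⁻¹ * ∑ i, c i * (‖v i‖ ^ 2 / 2) - W := fun v => by
    rw [hW, ← mul_sub, ← sum_sub_distrib, Fintype.card_fin]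
    congr 1
    exact sum_congr rfl fun i _ => by push_cast; ring
  simp_rw [hre]
  rw [sub_self, zero_pow two_ne_zero, add_zero] at hle
  have hmeas : Measurable fun v : Fin n → V3 => (n : ℝ)⁻¹ * ∑ i, c i * (‖v i‖ ^ 2 / 2) - W := by
    refine (measurable_const.mul (Finset.measurable_sum _ fun i _ => measurable_const.mul ?_)).sub_const _
    exact ((measurable_pi_apply i).norm.pow_const 2).div_const 2
  have hmem : MemLp (fun v : Fin n → V3 => (n : ℝ)⁻¹ * ∑ i, c i * (‖v i‖ ^ 2 / 2) - W) 2 (velMeasure u₀ θ₀ q) :=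
    (memLp_two_iff_integrable_sq hmeas.aestronglyMeasurable).2 hint
  refine ⟨hmem, (integral_abs_le_sqrt_of_memLp hmem).trans (Real.sqrt_le_sqrt hle)⟩

/-- The empirical momentum field of `zipConfig (q, v)` is measurable in the velocities. -/
theorem measurable_empiricalMomentumField_zip {n : ℕ} (q : Fin n → T3) (χ : T3 → ℝ) :
    Measurable fun v : Fin n → V3 => empiricalMomentumField (zipConfig (q, v)) χ := by
  have h : (fun v : Fin n → V3 => empiricalMomentumField (zipConfig (q, v)) χ) =
      fun v => (n : ℝ)⁻¹ • ∑ i, χ (q i) • v i := by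
    funext v
    rw [empiricalMomentumField_eq_sum]
    simp only [zipConfig_apply]
  rw [h]
  have hs : Measurable fun v : Fin n → V3 => ∑ i, χ (q i) • v i :=
    Finset.measurable_sum (f := fun i (v : Fin n → V3) => χ (q i) • v i) univ fun i _ =>
      ((measurable_pi_apply (X := fun _ : Fin n => V3) i).const_smul (χ (q i)) :
        Measurable fun v : Fin n → V3 => χ (q i) • v i)
  exact (hs.const_smul ((n : ℝ)⁻¹) : Measurable fun v : Fin n → V3 => (n : ℝ)⁻¹ • ∑ i, χ (q i) • v i)

/-- The empirical energy field of `zipConfig (q, v)` is measurable in the velocities. -/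
theorem measurable_empiricalEnergyField_zip {n : ℕ} (q : Fin n → T3) (χ : T3 → ℝ) :
    Measurable fun v : Fin n → V3 => empiricalEnergyField (zipConfig (q, v)) χ := by
  have h : (fun v : Fin n → V3 => empiricalEnergyField (zipConfig (q, v)) χ) =
      fun v => (n : ℝ)⁻¹ * ∑ i, χ (q i) * (‖v i‖ ^ 2 / 2) := by
    funext v
    rw [empiricalEnergyField_eq_sum]
    simp only [zipConfig_apply]
  rw [h]
  exact measurable_const.mul (Finset.measurable_sum _ fun i _ =>
    measurable_const.mul (((measurable_pi_apply i).norm.pow_const 2).div_const 2))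

/-- The empirical density field of `zipConfig (q, v)` does not depend on the velocities. -/
theorem empiricalDensityField_zip {n : ℕ} (q : Fin n → T3) (v : Fin n → V3) (χ : T3 → ℝ) :
    empiricalDensityField (zipConfig (q, v)) χ = (n : ℝ)⁻¹ * ∑ i, χ (q i) := by
  rw [empiricalDensityField_eq_sum]
  simp only [zipConfig_apply]

/-- **Conditional `L¹` deviation of the empirical momentum field** of `zipConfig (q, v)` from an
arbitrary vector `w`:
`E_v ‖n⁻¹ ∑ χ(qᵢ) vᵢ - w‖ ≤ ∑ₗ (√(∑ᵢ (n⁻¹χ(qᵢ))² θ₀(qᵢ)) + |n⁻¹ ∑ χ(qᵢ) u₀(qᵢ)ₗ - wₗ|)`,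
and the deviation is integrable. -/
theorem integral_norm_momentum_sub_le (hθ0 : ∀ x, 0 < θ₀ x) {n : ℕ} (q : Fin n → T3) (χ : T3 → ℝ)
    (w : V3) :
    Integrable (fun v : Fin n → V3 => ‖empiricalMomentumField (zipConfig (q, v)) χ - w‖) (velMeasure u₀ θ₀ q) ∧
    ∫ v, ‖empiricalMomentumField (zipConfig (q, v)) χ - w‖ ∂velMeasure u₀ θ₀ q ≤
      ∑ l, (Real.sqrt (∑ i, ((n : ℝ)⁻¹ * χ (q i)) ^ 2 * θ₀ (q i)) +
        |(n : ℝ)⁻¹ * ∑ i, χ (q i) * u₀ (q i) l - w l|) := by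
  set μv := velMeasure u₀ θ₀ q with hμv
  -- coordinatewise splitting
  set F : Fin 3 → (Fin n → V3) → ℝ := fun l v => (n : ℝ)⁻¹ * ∑ i, χ (q i) * (v i l - u₀ (q i) l) with hF
  set d : Fin 3 → ℝ := fun l => (n : ℝ)⁻¹ * ∑ i, χ (q i) * u₀ (q i) l - w l with hd
  have hcoord : ∀ (v : Fin n → V3) (l : Fin 3),
      (empiricalMomentumField (zipConfig (q, v)) χ - w) l = F l v + d l := by
    intro v l
    rw [PiLp.sub_apply, empiricalMomentumField_apply_sub (zipConfig (q, v)) χ u₀ l (w l)]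
    simp only [zipConfig_apply, hF, hd]
  have hFl : ∀ l, MemLp (F l) 2 μv ∧
      ∫ v, |F l v| ∂μv ≤ Real.sqrt (∑ i, ((n : ℝ)⁻¹ * χ (q i)) ^ 2 * θ₀ (q i)) :=
    fun l => integral_abs_momFluct_le hθ0 q (fun i => χ (q i)) l
  have hFint : ∀ l, Integrable (F l) μv := fun l => (hFl l).1.integrable one_le_two
  have hGint : ∀ l, Integrable (fun v => |F l v + d l|) μv := fun l =>
    ((hFint l).add (integrable_const _)).abs
  have hsum_int : Integrable (fun v => ∑ l, |F l v + d l|) μv := integrable_finsetSum _ fun l _ => hGint l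
  -- pointwise bound by the coordinate sum
  have hpt : ∀ v : Fin n → V3, ‖empiricalMomentumField (zipConfig (q, v)) χ - w‖ ≤ ∑ l, |F l v + d l| := by
    intro v
    refine (norm_le_sum_abs _).trans (le_of_eq (sum_congr rfl fun l _ => by rw [hcoord v l]))
  have hmeas : AEStronglyMeasurable (fun v : Fin n → V3 => ‖empiricalMomentumField (zipConfig (q, v)) χ - w‖) μv :=
    ((measurable_empiricalMomentumField_zip q χ).sub_const w).norm.aestronglyMeasurable
  have hint : Integrable (fun v : Fin n → V3 => ‖empiricalMomentumField (zipConfig (q, v)) χ - w‖) μv :=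
    hsum_int.mono' hmeas (ae_of_all _ fun v => by rw [norm_norm]; exact hpt v)
  refine ⟨hint, ?_⟩
  calc ∫ v, ‖empiricalMomentumField (zipConfig (q, v)) χ - w‖ ∂μv ≤ ∫ v, ∑ l, |F l v + d l| ∂μv :=
        integral_mono hint hsum_int hpt
    _ = ∑ l, ∫ v, |F l v + d l| ∂μv := integral_finsetSum _ fun l _ => hGint l
    _ ≤ ∑ l, (Real.sqrt (∑ i, ((n : ℝ)⁻¹ * χ (q i)) ^ 2 * θ₀ (q i)) +
          |(n : ℝ)⁻¹ * ∑ i, χ (q i) * u₀ (q i) l - w l|) := by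
        refine sum_le_sum fun l _ => ?_
        calc ∫ v, |F l v + d l| ∂μv ≤ ∫ v, (|F l v| + |d l|) ∂μv :=
              integral_mono (hGint l) ((hFint l).abs.add (integrable_const _)) fun v => abs_add_le _ _
          _ = (∫ v, |F l v| ∂μv) + |d l| := by
              rw [integral_add (hFint l).abs (integrable_const _), integral_const, probReal_univ, one_smul]
          _ ≤ _ := add_le_add (hFl l).2 le_rfl

/-- **Conditional `L¹` deviation of the empirical energy field** of `zipConfig (q, v)` from an
arbitrary `c`: with `e(y) = |u₀(y)|²/2 + 3θ₀(y)/2` and `Bᵢ = 6 θ₀(qᵢ)|u₀(qᵢ)|² + θ₀(qᵢ)² K₄/2`,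
`E_v |n⁻¹ ∑ χ(qᵢ)|vᵢ|²/2 - c| ≤ √(∑ᵢ (n⁻¹χ(qᵢ))² Bᵢ) + |n⁻¹ ∑ χ(qᵢ) e(qᵢ) - c|`,
and the deviation is integrable. -/
theorem integral_abs_energy_sub_le (hθ0 : ∀ x, 0 < θ₀ x) {n : ℕ} (q : Fin n → T3) (χ : T3 → ℝ)
    (c : ℝ) :
    Integrable (fun v : Fin n → V3 => |empiricalEnergyField (zipConfig (q, v)) χ - c|) (velMeasure u₀ θ₀ q) ∧
    ∫ v, |empiricalEnergyField (zipConfig (q, v)) χ - c| ∂velMeasure u₀ θ₀ q ≤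
      Real.sqrt (∑ i, ((n : ℝ)⁻¹ * χ (q i)) ^ 2 *
          (2 * 3 * θ₀ (q i) * ‖u₀ (q i)‖ ^ 2 + θ₀ (q i) ^ 2 / 2 * gaussFourthMomentConst (Fin 3))) +
        |(n : ℝ)⁻¹ * ∑ i, χ (q i) * (‖u₀ (q i)‖ ^ 2 / 2 + Fintype.card (Fin 3) * θ₀ (q i) / 2) - c| := by
  set μv := velMeasure u₀ θ₀ q with hμv
  set F : (Fin n → V3) → ℝ := fun v => (n : ℝ)⁻¹ * ∑ i, χ (q i) * (‖v i‖ ^ 2 / 2 - ‖u₀ (q i)‖ ^ 2 / 2 -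
      Fintype.card (Fin 3) * θ₀ (q i) / 2) with hF
  set d : ℝ := (n : ℝ)⁻¹ * ∑ i, χ (q i) * (‖u₀ (q i)‖ ^ 2 / 2 + Fintype.card (Fin 3) * θ₀ (q i) / 2) - c
    with hd
  have hsplit : ∀ v : Fin n → V3, empiricalEnergyField (zipConfig (q, v)) χ - c = F v + d := by
    intro v
    rw [empiricalEnergyField_sub (zipConfig (q, v)) χ u₀ θ₀ c]
    simp only [zipConfig_apply, hF, hd]
  obtain ⟨hmem, hle⟩ := integral_abs_energyFluct_le (u₀ := u₀) hθ0 q (fun i => χ (q i))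
  have hFint : Integrable F μv := hmem.integrable one_le_two
  simp_rw [hsplit]
  have hGint : Integrable (fun v => |F v + d|) μv := (hFint.add (integrable_const _)).abs
  refine ⟨hGint, ?_⟩
  calc ∫ v, |F v + d| ∂μv ≤ ∫ v, (|F v| + |d|) ∂μv :=
        integral_mono hGint (hFint.abs.add (integrable_const _)) fun v => abs_add_le _ _
    _ = (∫ v, |F v| ∂μv) + |d| := by
        rw [integral_add hFint.abs (integrable_const _), integral_const, probReal_univ, one_smul]
    _ ≤ _ := add_le_add hle le_rfl

end Velocity

end LGFS
end Summit.AtomisticToContinuum.HydrodynamicLimit.Theorems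
end
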